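/-
Copyright (c) 2026 the pub-hodgecm-mathlib formalisation cell (harness21).  Prover seat hodgecm-mathlib-R90-C10-p04 (g2), SLAB R90-TF, section S1 «Ch. 10∕12 local»,
S1 WAVE E3-PAY hand (W1) (dealer R90-C10-plan (g2), R-S1-10): the `weylIntegration` conjunct of ★ `ExtE3FinDatum` paid from the record pins ★ `IsRecordDatumG`,
crux H413 = `stmt-HodgeConjecture-24833`.  KERNEL module: THEOREMS ONLY (no definition, no named fact, no `sorry`, no instance, no notation).  2026-09-04.
-/
import Summits.HodgeConjecture.HodgeConjecture.Theorems.R90S1ClosureE3Defs              -- ★ p862727 (R90-C10-typ2 (g2)) D1: `IsRecordDatumG`, `ExtE3FinDatum` (the E3 closure-socket vocabulary)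
import Summits.HodgeConjecture.HodgeConjecture.Theorems.F0P3cStCharTSWeylDatumPinsWIF    -- ★ (LH5-p02 (g7)) WIF-AT-THE-DATUM by pins: `weylIntegrationFormula_of_datumPins`
import Summits.HodgeConjecture.HodgeConjecture.Theorems.F0P3cStCharTSJacCartanTerminus   -- ★ p852343 (LH5-p02 (g7)) JAC-ELL C8 terminus: `tubeJacobianSocket_compactCartan`
import Summits.HodgeConjecture.HodgeConjecture.Theorems.F0P3cStCharTSCartanFields        -- ★ p851300 (LH6-p01) S9a: `ellCartanAE_of_compact_centralizers`, `nonEllCartanAE_of_split`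
import Summits.HodgeConjecture.HodgeConjecture.Theorems.F0P3cStCharTSCartanNull          -- ★ p851303 (F0P3-p04) S9b′: `cartanNull_of_rootKernels`
import Summits.HodgeConjecture.HodgeConjecture.Theorems.F0P3cStCharTSCartanReps          -- ★ `exists_isRegularElt_centralizer_eq_cmTorus` (`M = Z(m₀)`, `m₀` regular)
import Summits.HodgeConjecture.HodgeConjecture.Theorems.F0P3cStCharTSSocketsOut          -- ★ (DENS) `weylDensity_gqs_of_ellCartanAE`
import HarnessLib

/-!
# R90 · S1 (Rogawski 1990 Ch. 12, local) · (E3) closure socket — the `weylIntegration` conjunct of `ExtE3FinDatum` from the record pins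

Cell `pub/hodgecm-mathlib` (D-0151), SLAB R90-TF, section S1 «Ch. 10∕12 local», crux H413 = `stmt-HodgeConjecture-24833` (lane `--supports … --as helper`), route of
record `HCCMUnconditional` (no route verbs); prover seat `hodgecm-mathlib-R90-C10-p04` (g2), S1 WAVE E3-PAY hand (W1) (R90-C10-plan (g2) R-S1-10, 2026-09-04T23:03:46Z;
szE3.1 (g2) 22:54:54Z (4) ∕ R90-C10-typ2 (g2) 22:59:20Z «PAYABLE NOW»).  THEOREMS ONLY (no `def`, no `instance`, no notation, no named-fact hypothesis, no `sorry`);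
★-only imports (no `Lines` import).

THE POINT.  ★ D1 `R90S1ClosureE3Defs` (p862727) fields the §12.5 relations of the (E3) closure socket PINS-THEN-RELATION: `∀ ⟪frame⟫ 𝔇, IsRecordDatumG … 𝔇 → ExtE3FinDatum 𝔇`.
Its first field `ExtE3FinDatum.weylIntegration : 𝔇.WeylIntegrationFormula ∧ 𝔇.WeylDensity ∧ 𝔇.EllCartanSubset ∧ 𝔇.EllCartanAE ∧ 𝔇.NonEllCartanAE` (row E3.P3: the Weyl
integration formula «`∫_{Z\G} f α dg = Σ_T |Ω(T,G)|⁻¹ ∫_{Z\T} D_G² Φ(γ,f) α(γ) dγ`», p. 182, with its tacit companions pp. 182, 184) is PAYABLE TODAY from the eighteen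
G-side pins by EXISTING ★ payers, token for token as ★ `K2E3DatumJunction17LeThree.ellipticPackage_body_of_inputs₁₇` :245–246, :264–288 does inside the (S-𝔇) organ:
* `WeylIntegrationFormula` := ★ `F0P3cStCharTSWeylDatumPinsWIF.weylIntegrationFormula_of_datumPins` over the pins `μG_eq orb_eq regG_iff cartanAll_cover cartanAll_nonconj
  cartanAll_cpt μT_inv μT_core dG_eq`, the frame's `hcanQ`, the two derived clauses `hShapeA` (every representative is the centralizer of a regular element: `M = Z(m₀)` by ★
  `F0P3cStCharTSCartanReps.exists_isRegularElt_centralizer_eq_cmTorus`, the elliptic ones by `cartanG_spec`) and `hHaarT` (`haarM` ∕ `haarG`), and the compact-Cartan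
  tube-Jacobian socket IN HOUSE ★ `F0P3cStCharTSJacCartanTerminus.tubeJacobianSocket_compactCartan`;
* `EllCartanAE` (C2) := ★ `F0P3cStCharTSCartanFields.ellCartanAE_of_compact_centralizers` over `ellG_iff`, `cartanG_spec` and the CARTAN-NULL device ★
  `F0P3cStCharTSCartanNull.cartanNull_of_rootKernels` (`haarG`, compactness from `cartanG_spec`, `kerG`);
* `EllCartanSubset` (C1) := `cartanAll_iff` read right to left;
* `NonEllCartanAE` (C3) := ★ `F0P3cStCharTSCartanFields.nonEllCartanAE_of_split` over `regG_iff`, `ellG_iff`, `cartanAll_iff`, `haarM`;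
* `WeylDensity` (DENS) := ★ `F0P3cStCharTSSocketsOut.weylDensity_gqs_of_ellCartanAE` over `μG_eq`, (C2) and (E⊆R) `𝔇.ellG ⊆ 𝔇.regG` (from `regG_iff` ∕ `ellG_iff`).
BINDERS = the telescope of ★ `ExtE3Fin.datum` (D1 :309–320) with `H` GENERIC `{H : Type} [Group H] [TopologicalSpace H] [IsTopologicalGroup H] [MeasurableSpace H]` (as ★
`IsRecordDatumG`; the record `H_v = U(Φ₂)(L⁺_v) × U(Φ₁)(L⁺_v)` instantiates — the `MeasurableSpace H_v` binder :315–316 is the generic `[MeasurableSpace H]`), then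
`(𝔇 : EllipticData (Gqs L v) H) (h𝔇 : IsRecordDatumG L v νQv μZ mQv 𝔇)`; CONCLUSION = the TYPE of the field `ExtE3FinDatum.weylIntegration` (D1 :278) verbatim.  The
topological instances `LocallyCompactSpace ∕ SecondCountableTopology ∕ T2Space (Gqs L v)` the WIF payer binds are synthesized from the ★ organ instances (as at ★
`K2E3DatumJunction17LeThree` :272), not added as binders.
* **`weylIntegration_of_isRecordDatumG`** — (W1): `IsRecordDatumG L v νQv μZ mQv 𝔇 → (the five-conjunct type of ExtE3FinDatum.weylIntegration)`.
HONEST LABEL.  HC_CM is proved only modulo the 7 printed citations (2 remaining named inputs: hLiu418 = `stmt-HodgeConjecture-24832`, h413 = `stmt-HodgeConjecture-24833`)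
until rung 0 closes; count-neutral — this file pays ONE conjunct-group of a closure BUILD TARGET (row E3.P3) from the record pins and closes NOTHING at rung 0; the LAW ∕
STRUCTURE pins of `IsRecordDatumG` stay hypotheses (the K2E3 estate's standing business); REL ≠ ★ ≠ BUILT.

## References
* [Rogawski1990] J. D. Rogawski, *Automorphic Representations of Unitary Groups in Three Variables*, Ann. of Math. Stud. 123 (1990), §12.5 pp. 182–184 (the Weyl
  integration formula and the elliptic set), §4.3 (4.3.1) p. 43, §4.9 p. 55 (held scan book:rogawski1990-automorphic-representations-unitary-groups-three-variables,
  chunks p0175–p0177).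
* [HarishChandra1970] Harish-Chandra, *Harmonic analysis on reductive p-adic groups* (notes by G. van Dijk), LNM 162 (1970), the Weyl integration formula.
-/

set_option autoImplicit false
-- the mandated namespace has the single-problem summit's repeated segment (`HodgeConjecture.HodgeConjecture`)
set_option linter.dupNamespace false

noncomputable section

open MeasureTheory Measure Filter Topology NumberField IsDedekindDomain
open scoped NNReal Matrix MatrixGroups
open Literature.MeasureTheory.Group
open Literature.NumberTheory.Rogawski1990 Literature.NumberTheory.Rogawski1990.Ch12Sec5
open Literature.NumberTheory.Automorphic Literature.NumberTheory.Automorphic.UnitaryGroup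
open Summit.HodgeConjecture.HodgeConjecture.Cruxes.H413
open Summit.HodgeConjecture.HodgeConjecture.Cruxes.H413.F0P3cStCharTSTorusDefs (hyperbolicSet)

namespace Summit.HodgeConjecture.HodgeConjecture.R90.S1

/-! ## (W1) The `weylIntegration` conjunct of `ExtE3FinDatum` from the record pins -/

set_option synthInstance.maxHeartbeats 400000 in
-- as the ★ WIF payer `F0P3cStCharTSWeylDatumPinsWIF` does (the `Gqs L v` instance path is long)
/-- **(W1) — row E3.P3 of the (E3) closure socket, PAID FROM THE RECORD PINS: the Weyl integration formula and its tacit companions.**  At a CM field `L`, a finite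
place `v` of `L⁺` that does not split in `L`, a Haar measure `νQv` on `G = U(Φ₃)(L⁺_v) = Gqs L v`, a Haar measure `μZ` on `G ⧸ Z(G)` and the canonical orbital family `mQv`
(`hcanQ`), every §12.5 datum `𝔇 : EllipticData (Gqs L v) H` carrying the record pins ★ `IsRecordDatumG L v νQv μZ mQv 𝔇` satisfies
`𝔇.WeylIntegrationFormula ∧ 𝔇.WeylDensity ∧ 𝔇.EllCartanSubset ∧ 𝔇.EllCartanAE ∧ 𝔇.NonEllCartanAE` — «`∫_{Z\G} f α dg = Σ_T |Ω(T,G)|⁻¹ ∫_{Z\T} D_G(γ)² Φ(γ,f) α(γ) dγ`» for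
every set of representatives `T` of the conjugacy classes of Cartan subgroups (p. 182), two admissible densities with equal integrals agree `dγ`-a.e. on the elliptic tori,
the elliptic representatives are among the representatives, `dγ`-almost every element of an elliptic torus is elliptic regular and of `M` is regular non-elliptic (p. 184:
the singular set is `dγ`-null, `G^e ⊆ G^r`).  Binders = the telescope of ★ `ExtE3Fin.datum` with `H` generic; conclusion = the type of ★ `ExtE3FinDatum.weylIntegration`
verbatim.  Body: ★ `weylIntegrationFormula_of_datumPins` (WIF by pins, compact-Cartan tube-Jacobian socket ★ `tubeJacobianSocket_compactCartan`, `M = Z(m₀)` ★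
`exists_isRegularElt_centralizer_eq_cmTorus`), (C2) ★ `ellCartanAE_of_compact_centralizers` ∘ ★ `cartanNull_of_rootKernels`, (C1) `cartanAll_iff`, (C3) ★
`nonEllCartanAE_of_split`, (DENS) ★ `weylDensity_gqs_of_ellCartanAE` with (E⊆R) from `regG_iff` ∕ `ellG_iff` — the recipe of ★ `K2E3DatumJunction17LeThree` :245–288.
[cite: Rogawski1990, §12.5 p. 182, p. 184; §4.3 (4.3.1) p. 43; §4.9 p. 55] [cite: HarishChandra1970, Weyl integration formula] -/
theorem weylIntegration_of_isRecordDatumG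
    (L : Type) [Field L] [NumberField L] [IsCMField L] (v : HeightOneSpectrum (𝓞 ↥(maximalRealSubfield L)))
    (hns : ∀ w : PlacesOver L v, IsCMField.complexConj L • w.1 = w.1)
    [MeasurableSpace (Gqs L v)] [BorelSpace (Gqs L v)]
    [∀ γ : Gqs L v, MeasurableSpace (Gqs L v ⧸ Subgroup.centralizer ({γ} : Set (Gqs L v)))]
    [∀ γ : Gqs L v, BorelSpace (Gqs L v ⧸ Subgroup.centralizer ({γ} : Set (Gqs L v)))]
    [MeasurableSpace (Gqs L v ⧸ Subgroup.center (Gqs L v))] [BorelSpace (Gqs L v ⧸ Subgroup.center (Gqs L v))]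
    {H : Type} [Group H] [TopologicalSpace H] [IsTopologicalGroup H] [MeasurableSpace H]
    (νQv : Measure (Gqs L v)) [νQv.IsHaarMeasure] [νQv.IsMulRightInvariant]
    (μZ : Measure (Gqs L v ⧸ Subgroup.center (Gqs L v))) [μZ.IsHaarMeasure]
    (mQv : OrbitalMeasureFamily (Gqs L v))
    (hcanQ : mQv.IsCanonical (fun γ => IsRegularElt (γ.val : GL (Fin 3) (UnitaryGroup.LocalRing L v))) νQv)
    (𝔇 : EllipticData (Gqs L v) H) (h𝔇 : IsRecordDatumG L v νQv μZ mQv 𝔇) :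
    𝔇.WeylIntegrationFormula ∧ 𝔇.WeylDensity ∧ 𝔇.EllCartanSubset ∧ 𝔇.EllCartanAE ∧ 𝔇.NonEllCartanAE := by
  -- every Cartan representative is the centralizer of a regular element: `M = Z(m₀)` (★ CartanReps), the elliptic ones by the pin `cartanG_spec`
  have hShapeA : ∀ T' ∈ 𝔇.cartanAll, ∃ γ₀ : Gqs L v, IsRegularElt (γ₀.val : GL (Fin 3) (UnitaryGroup.LocalRing L v)) ∧
      T' = Subgroup.centralizer ({γ₀} : Set (Gqs L v)) := fun T' hT' => by
    rcases (h𝔇.cartanAll_iff T').1 hT' with h | h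
    · subst h
      obtain ⟨m₀, -, hreg, hZ⟩ := F0P3cStCharTSCartanReps.exists_isRegularElt_centralizer_eq_cmTorus L v hns
      exact ⟨m₀, hreg, hZ.symm⟩
    · exact (h𝔇.cartanG_spec T' h).2
  -- every representative's `dγ` is a Haar measure (pins `haarM` ∕ `haarG`)
  have hHaarT : ∀ T' ∈ 𝔇.cartanAll, (𝔇.μT T').IsHaarMeasure := fun T' hT' => by
    rcases (h𝔇.cartanAll_iff T').1 hT' with h | h
    · subst h; exact h𝔇.haarM
    · exact h𝔇.haarG T' h
  -- ★ WIF-AT-THE-DATUM from the Cartan pins; the compact-Cartan tube-Jacobian socket by ★ JAC-ELL C8 `tubeJacobianSocket_compactCartan`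
  have hWIF : 𝔇.WeylIntegrationFormula :=
    F0P3cStCharTSWeylDatumPinsWIF.weylIntegrationFormula_of_datumPins L v hns νQv mQv 𝔇 h𝔇.μG_eq h𝔇.orb_eq hcanQ h𝔇.regG_iff
      hShapeA h𝔇.cartanAll_cover h𝔇.cartanAll_nonconj h𝔇.cartanAll_cpt hHaarT h𝔇.μT_inv h𝔇.μT_core h𝔇.dG_eq
      (F0P3cStCharTSJacCartanTerminus.tubeJacobianSocket_compactCartan L v hns νQv)
  -- (C2): `dγ`-a.e. `γ ∈ T` is elliptic regular on every elliptic representative (compact centralizers + the CARTAN-NULL device)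
  have hC2 : 𝔇.EllCartanAE :=
    F0P3cStCharTSCartanFields.ellCartanAE_of_compact_centralizers L v 𝔇 h𝔇.ellG_iff h𝔇.cartanG_spec
      (F0P3cStCharTSCartanNull.cartanNull_of_rootKernels L v 𝔇 h𝔇.haarG (fun T hT => (h𝔇.cartanG_spec T hT).1) h𝔇.kerG)
  -- (C1): the elliptic representatives are representatives
  have hC1 : 𝔇.EllCartanSubset := fun T hT => (h𝔇.cartanAll_iff T).2 (Or.inr hT)
  -- (C3): `dγ`-a.e. `γ ∈ M` is regular and not elliptic
  have hC3 : 𝔇.NonEllCartanAE :=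
    F0P3cStCharTSCartanFields.nonEllCartanAE_of_split L v 𝔇 h𝔇.regG_iff h𝔇.ellG_iff
      (fun T hT hTn => ((h𝔇.cartanAll_iff T).1 hT).resolve_right hTn) h𝔇.haarM
  -- (E⊆R) from the two set pins, then (DENS)
  have hER : 𝔇.ellG ⊆ 𝔇.regG := fun γ hγ => (h𝔇.regG_iff γ).2 ((h𝔇.ellG_iff γ).1 hγ).1
  have hDens : 𝔇.WeylDensity := F0P3cStCharTSSocketsOut.weylDensity_gqs_of_ellCartanAE L v νQv 𝔇 h𝔇.μG_eq hC2 hER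
  exact ⟨hWIF, hDens, hC1, hC2, hC3⟩

end Summit.HodgeConjecture.HodgeConjecture.R90.S1

end
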